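import Summits.BirchSwinnertonDyer.BirchSwinnertonDyer.Theorems.ClassRecordThreeEulerHalvesAtThreeWalkSupplyPT
import HarnessLib

/-!
# T1 JET (cell `bsd-jet`), road K — striking McCallum 1991 Prop. 5.2 (`h52`), brick 1: the EXCLUSION
# LEMMA at one Kolyvagin place (Kolyvagin's prime-swap step, global-duality half)

HONEST FRAMING (programme file §HONESTY, verbatim): «no tranche here proves BSD; ARM L moves the
LITERAL column of an r ≤ 1 census into the kernel-proved-modulo-named-print column.» THEOREMS ONLY
(seat `bsd-jet-pv-2`, session g6; `--supports stmt-BirchSwinnertonDyer-14418`, helper); 0 classes move;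
road-K DOCUMENTARY. Nothing here is asserted about any curve; no item closes.

WHAT. The END FORMS `JET.jetchevDivisibilityCarrier{Mult,Ne,Add}_of_namedPrintOnly` (p539525) carry the
named-print binder `h52 = McCallum1991.prop52_exists_conductor_kolyvaginClass_order_eq` (McCallum 1991
Prop. 5.2, case `C = {0}`), consumed by the bridge `JET.derivedPoint_divisible_of_prop52_of_section6_min`
ONLY as «level raising at minimal depth». Its printed proof (McCallum, LMS LN 153, pp. 305–306) is
Kolyvagin's PRIME-SWAP walk `n ↦ n·ℓ'/ℓ₀`; the swap step rests on ONE global-duality argument (McCallum's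
sum (13) with Lemma 5.3 and Prop. 2.2). This file proves that argument in the tree's Selmer-structure
currency, as the **exclusion lemma** `localization_eq_zero_of_strict_of_relaxed`: at the level `p^k`, for
the structure `𝓕(c) = selmerF W p^k 𝒯 (placesDividing K c)`, a `τ`-fixed finite place `λ₀ ∉ (c)` and
the place `λ` over a Kolyvagin prime `ℓ ∤ c` of index `≥ k`, `λ ≠ λ₀`: IF a class `y` of sign `s` is
`𝓕(c)` everywhere off `{λ₀, λ}`, ZERO at `λ₀` and NOT Kummer at `λ`, THEN every class `t` of sign `s`
which is `𝓕(c)` off `λ₀` (anything at `λ₀`, i.e. `t ∈ H¹_{𝓕(c)^{λ₀}}`) DIES at `λ`: `loc_λ t = 0`.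
PROOF: pv-1's signed one-place formula `relIndex_mul_natCard_map_eq_of_relaxedAt` (Jetchev Lemma
5.2 (iii) / Howard Thm. 2.1.11, signed) for the pair `𝓕 ≤ 𝓕^{λ}` with `𝓕 := 𝓕(c)[λ₀ ↦ 0]` (STRICT at
`λ₀`): `[H¹_{𝓕^λ}^s : H¹_𝓕^s] · #loc'_λ((H¹_{𝓕^*})^s) = [H¹(K_λ)^s : Kum_λ^s]`; the right side is the
local index `hloc`, asked to be a PRIME `q` (at level `p` it is `p`, pv-1's
`relIndex_kummer_ker_conjActPlace_eq_pow`; the swap walk runs at level `p`); the class `y` makes the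
first factor `≠ 1`, hence `#loc'_λ((H¹_{𝓕^*})^s) = 1`. The dual side is transported back to `E[n]` by the Weil transport
(`comap_map_weilDual_selmerGroup`; `(𝓕(c)[λ₀ ↦ 0])^∨ = 𝓕(c)^{λ₀}` since `𝓕(c)` is self-dual,
`dualTransported_selmerF_eq`, and `0^* = ⊤`), and `#loc'_λ = 1` kills `loc_λ t` by the local
injectivity of the Weil transport. This replaces McCallum's explicit reciprocity sum (13) — whose
printed level-`p` version pairs `c ∈ H¹(K, E_p)` against the UNDIVIDED class `c_{M_r+1}(nℓ')` and is
only correct for the divided classes `[P_n / p^{M_r}]` (reading note in the cell's STATUS) — by the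
exact global-duality count. References (locators only; no cited FACT is declared):
[cite: McCallumLMS1991, §5 Prop. 5.2 and its proof (pp. 304–306), Lemma 5.3, §2 Prop. 2.1–2.2]
[cite: Jetchev2008, Thm. 5.1, Lemma 5.2 (p. 822)] [cite: Howard2004HeegnerKolyvagin, Thm. 2.1.11]
[cite: MilneADT2006, Ch. I, Cor. 2.3, Thm. 4.10(b)]. Design: no definitions; `K : Type`. Axioms:
`propext`, `Classical.choice`, `Quot.sound`.
-/

set_option autoImplicit false

noncomputable section

open scoped Classical Pointwise
open Function NumberField IsDedekindDomain WeierstrassCurve Field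
open Literature.NumberTheory.EllipticCurves Literature.NumberTheory.GaloisRepresentations
open Literature.NumberTheory.EllipticCurves.Jetchev2008
open Literature.NumberTheory.GaloisCohomology Literature.NumberTheory.Automorphic
open Literature.NumberTheory.GaloisRepresentations.DiscreteGaloisModule (localTatePairingZMod
  tateDual SelmerStructure)
open Summit.BirchSwinnertonDyer.Rank1Residual.JET.SelmerVocabulary
open Summit.BirchSwinnertonDyer.Rank1Residual.JET.GlobalDuality
open Literature.NumberTheory.NumberFields.Honda1971 (natCast_notMem_of_coprime)

namespace Summit.BirchSwinnertonDyer.Rank1Residual.JET.Swap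

/-! ### Arithmetic: a product equal to a prime with first factor `≠ 1` -/

/-- If `a * b = q` with `q` prime and `a ≠ 1` then `b = 1`. Elementary. [folklore] -/
theorem eq_one_of_mul_eq_prime {a b q : ℕ} (hq : q.Prime) (h : a * b = q) (ha : a ≠ 1) : b = 1 := by
  have hb : b ∣ q := ⟨a, by rw [mul_comm]; exact h.symm⟩
  rcases (Nat.dvd_prime hq).mp hb with hb1 | hbq
  · exact hb1
  · subst hbq
    have hb0 : b ≠ 0 := hq.ne_zero
    have : a = 1 := by
      have h' : a * b = 1 * b := by rw [h, one_mul]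
      exact Nat.eq_of_mul_eq_mul_right (Nat.pos_of_ne_zero hb0) h'
    exact absurd this ha

/-! ### The transported dual of a structure made STRICT at one place -/

section Strict

variable {K : Type} [Field K] [NumberField K] (W : WeierstrassCurve ℚ) [(W.baseChange K).IsElliptic]
  (N : ℕ) [NeZero N] [Finite (geomTorsion (W.baseChange K) N)]
  (e : geomTorsion (W.baseChange K) N → geomTorsion (W.baseChange K) N → AlgebraicClosure K)
  (hμ : ∀ S T, e S T ^ N = 1)
  (hadd₁ : ∀ S₁ S₂ T, e (S₁ + S₂) T = e S₁ T * e S₂ T)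
  (hadd₂ : ∀ S T₁ T₂, e S (T₁ + T₂) = e S T₁ * e S T₂)
  (hgal : ∀ (g : absoluteGaloisGroup K) (S T : geomTorsion (W.baseChange K) N),
    g • e S T = e (g • S) (g • T))

/-- **`(𝓕[λ₀ ↦ 0])^∨ = 𝓕^∨[λ₀ ↦ ⊤]`**: making a structure strict at `λ₀` makes its transported dual
relaxed at `λ₀` and leaves it unchanged elsewhere (`0^* = H¹(K_{λ₀}, E[N]^D)`, Howard Def. 2.1.6).
[cite: Howard2004HeegnerKolyvagin, Def. 2.1.6 (arXiv:1202.6340 p. 5)] -/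
theorem dualTransported_update_bot (inv : LocalInvariants K N)
    (𝓕 : SelmerStructure ((W.baseChange K).torsionGaloisModule N)) (v₀ : Place K) (v : Place K) :
    inv.dualTransported (Function.update 𝓕 v₀ ⊥)
        (weilDualIntertwining (W.baseChange K) N e hμ hadd₁ hadd₂ hgal) v =
      if v = v₀ then ⊤
      else inv.dualTransported 𝓕 (weilDualIntertwining (W.baseChange K) N e hμ hadd₁ hadd₂ hgal) v := by
  by_cases hv : v = v₀
  · subst hv
    rw [if_pos rfl]
    change (inv.dualSelmerStructure _ (Function.update 𝓕 v ⊥) v).comap _ = ⊤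
    rw [LocalInvariants.dualSelmerStructure_apply, Function.update_self,
      LocalInvariants.dualLocalCondition_bot, AddSubgroup.comap_top]
  · rw [if_neg hv]
    exact dualTransported_congr W N e hμ hadd₁ hadd₂ hgal inv (Function.update_of_ne hv _ _)

end Strict

/-! ### A trivial dual image kills the localisation of every transported class -/

section DualImage

variable {K : Type} [Field K] [NumberField K] (W : WeierstrassCurve ℚ) [W.IsElliptic]
  (τ : K ≃ₐ[ℚ] K) (N : ℕ) [NeZero N] [Finite (geomTorsion (W.baseChange K) N)]
  (e : geomTorsion (W.baseChange K) N → geomTorsion (W.baseChange K) N → AlgebraicClosure K)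
  (hμ : ∀ S T, e S T ^ N = 1)
  (hadd₁ : ∀ S₁ S₂ T, e (S₁ + S₂) T = e S₁ T * e S₂ T)
  (hadd₂ : ∀ S T₁ T₂, e S (T₁ + T₂) = e S T₁ * e S T₂)
  (hgal : ∀ (g : absoluteGaloisGroup K) (S T : geomTorsion (W.baseChange K) N),
    g • e S T = e (g • S) (g • T))
  (hnondeg : ∀ T, (∀ S, e S T = 1) → T = 0)
  (hτe : ∀ S T, liftAut τ (e S T) =
    e ((isLiftOfAut_liftAut τ).torsionMap W N S) ((isLiftOfAut_liftAut τ).torsionMap W N T))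

include hnondeg hτe in
/-- **`#loc'_λ((H¹_{𝓕^*})^s) = 1` kills `loc_λ` on `(H¹_{𝓕^∨})^s`.** If the image at `λ` of the
`s`-eigenclasses of the dual Selmer group `H¹_{𝓕^*}(K, E[N]^D)` is trivial, then every `s`-eigenclass `t`
of the transported structure `𝓕^∨ = w⁻¹(𝓕^*)` on `E[N]` has `loc_λ t = 0`: its Weil transport `w t` lies
in `(H¹_{𝓕^*})^s` (`comap_map_weilDual_selmerGroup`, `conjActDual_map_weilDual_eq_smul_iff`), so
`loc'_λ (w t) = w_λ (loc_λ t) = 0`, and the local transport `w_λ` is injective.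
[cite: MilneADT2006, Ch. I §6, proof of Prop. 6.9] [cite: Jetchev2008, Lemma 5.2 (iii) (p. 822)] -/
theorem localization_eq_zero_of_natCard_dualImage_eq_one (inv : LocalInvariants K N)
    (𝓕 : SelmerStructure ((W.baseChange K).torsionGaloisModule N)) (v : Place K) (s : ℤ)
    (hcard : Nat.card (((inv.dualSelmerStructure ((W.baseChange K).torsionGaloisModule N) 𝓕).selmerGroup ⊓
        (conjActDual W τ N N - s • AddMonoidHom.id _).ker).map
        (galoisCohomology.localization (((W.baseChange K).torsionGaloisModule N).tateDual N) v 1)) = 1)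
    (t : galoisCohomology ((W.baseChange K).torsionGaloisModule N) 1)
    (ht : t ∈ (inv.dualTransported 𝓕
      (weilDualIntertwining (W.baseChange K) N e hμ hadd₁ hadd₂ hgal)).selmerGroup)
    (hts : conjAct W τ N t = s • t) :
    galoisCohomology.localization ((W.baseChange K).torsionGaloisModule N) v 1 t = 0 := by
  set wH := galoisCohomology.map (weilDualIntertwining (W.baseChange K) N e hμ hadd₁ hadd₂ hgal) 1
    with hwH
  -- `w t ∈ (H¹_{𝓕^*})^s`
  have hmem : wH t ∈ (inv.dualSelmerStructure ((W.baseChange K).torsionGaloisModule N) 𝓕).selmerGroup ⊓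
      (conjActDual W τ N N - s • AddMonoidHom.id _).ker := by
    refine AddSubgroup.mem_inf.mpr ⟨?_, ?_⟩
    · have h := ht
      rw [← comap_map_weilDual_selmerGroup W N e hμ hadd₁ hadd₂ hgal inv 𝓕] at h
      exact h
    · rw [AddMonoidHom.mem_ker, AddMonoidHom.sub_apply, AddMonoidHom.smul_apply,
        AddMonoidHom.id_apply, sub_eq_zero]
      exact (conjActDual_map_weilDual_eq_smul_iff W N e hμ hadd₁ hadd₂ hgal hnondeg τ hτe s t).mpr hts
  -- its image at `v` lies in a trivial subgroup
  have hzero : galoisCohomology.localization (((W.baseChange K).torsionGaloisModule N).tateDual N) v 1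
      (wH t) = 0 := by
    have hbot := (AddSubgroup.card_eq_one.mp hcard)
    have hin : galoisCohomology.localization (((W.baseChange K).torsionGaloisModule N).tateDual N) v 1
        (wH t) ∈ (((inv.dualSelmerStructure ((W.baseChange K).torsionGaloisModule N) 𝓕).selmerGroup ⊓
          (conjActDual W τ N N - s • AddMonoidHom.id _).ker).map
          (galoisCohomology.localization (((W.baseChange K).torsionGaloisModule N).tateDual N) v 1)) :=
      AddSubgroup.mem_map_of_mem _ hmem
    rw [hbot, AddSubgroup.mem_bot] at hin
    exact hin
  -- `loc'_v ∘ w = w_v ∘ loc_v` and `w_v` is injective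
  have hnat : galoisCohomology.localization (((W.baseChange K).torsionGaloisModule N).tateDual N) v 1
      (wH t) = galoisCohomology.map ((weilDualIntertwining (W.baseChange K) N e hμ hadd₁ hadd₂
        hgal).restrictField (Place.Completion v)) 1
        (galoisCohomology.localization ((W.baseChange K).torsionGaloisModule N) v 1 t) :=
    galoisCohomology.res_map_one (Place.Completion v) _ t
  rw [hnat] at hzero
  exact X11b.LocBridge.map_weilDual_restrictField_injective (W.baseChange K) N e hμ hadd₁ hadd₂ hgal
    hnondeg (Place.Completion v) (by rw [hzero]; exact (map_zero _).symm)

end DualImage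

/-! ### The exclusion lemma -/

section Exclusion

variable {K : Type} [Field K] [NumberField K] (W : WeierstrassCurve ℚ) [W.IsElliptic]
  [W.IsGloballyMinimal]
  (τ : K ≃ₐ[ℚ] K) (p k : ℕ) [Fact p.Prime] [NeZero (p ^ k)]
  [Finite (geomTorsion (W.baseChange K) ((p ^ k : ℕ) : ℤ))]
  (e : geomTorsion (W.baseChange K) ((p ^ k : ℕ) : ℤ) → geomTorsion (W.baseChange K) ((p ^ k : ℕ) : ℤ) →
    AlgebraicClosure K)
  (hμ : ∀ S T, e S T ^ (p ^ k) = 1)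
  (hadd₁ : ∀ S₁ S₂ T, e (S₁ + S₂) T = e S₁ T * e S₂ T)
  (hadd₂ : ∀ S T₁ T₂, e S (T₁ + T₂) = e S T₁ * e S T₂)
  (hgal : ∀ (g : absoluteGaloisGroup K) (S T : geomTorsion (W.baseChange K) ((p ^ k : ℕ) : ℤ)),
    g • e S T = e (g • S) (g • T))
  (halt : ∀ T, e T T = 1) (hnondeg : ∀ T, (∀ S, e S T = 1) → T = 0)
  (hτe : ∀ S T, liftAut τ (e S T) =
    e ((isLiftOfAut_liftAut τ).torsionMap W ((p ^ k : ℕ) : ℤ) S)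
      ((isLiftOfAut_liftAut τ).torsionMap W ((p ^ k : ℕ) : ℤ) T))

include halt hnondeg hτe in
/-- **EXCLUSION LEMMA (Kolyvagin's swap step, global-duality half; McCallum's (13) as a count).** Level
`p^k` with the local index `[H¹(K_λ)^s : Kum_λ^s]` at Kolyvagin places of index `≥ k` a PRIME (`hloc`,
so in practice `k = 1`); `𝓕(c) = selmerF W p^k 𝒯 (placesDividing K c)` with `𝒯` `τ`-stable and
self-dual at the places of `c`; the Poitou–Tate package `inv` (perfect, sum of local terms zero,
Selmer complement, `τ`-compatible) and a `τ`-equivariant Weil datum; a `τ`-FIXED finite place `v₀`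
not dividing `c`; the place `v` over a Kolyvagin prime `ℓ ∤ c` of index `≥ k` with `v ≠ v₀`; a sign
`s = ±1`. IF `y` is an `s`-eigenclass with the `𝓕(c)` condition at every finite place `∉ {v₀, v}`,
`loc_{v₀} y = 0` and `loc_v y ∉ Kum_v`, THEN every `s`-eigenclass `t ∈ H¹_{𝓕(c)^{v₀}}` has `loc_v t = 0`.
Proof: the signed formula for `𝓕(c)[v₀ ↦ 0] ≤ (𝓕(c)[v₀ ↦ 0])^{v}`; `y` is in the relaxed group and not
in the strict one, so the relative index is `≠ 1`; the product being prime, `#loc'_v((H¹_{𝓕^*})^s) = 1`;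
`(𝓕(c)[v₀ ↦ 0])^∨ = 𝓕(c)^{v₀} ∋ t` (`dualTransported_selmerF_eq`, `dualTransported_update_bot`);
conclude by `localization_eq_zero_of_natCard_dualImage_eq_one`.
[cite: McCallumLMS1991, §5, proof of Prop. 5.2 (pp. 305–306), Lemma 5.3] [cite: Jetchev2008, Thm. 5.1,
Lemma 5.2 (p. 822)] [cite: Howard2004HeegnerKolyvagin, Thm. 2.1.11] -/
theorem localization_eq_zero_of_strict_of_relaxed (hτ : τ * τ = 1) (hp2 : p ≠ 2) (hk : 1 ≤ k)
    (inv : LocalInvariants K (p ^ k)) (hperf : inv.IsPerfect) (hvan : inv.SumLocalTermEqZero)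
    (hSC : inv.SelmerComplement) (hinv : inv.IsConjCompatible τ)
    (𝒯 : SelmerStructure ((W.baseChange K).torsionGaloisModule ((p ^ k : ℕ) : ℤ)))
    {c : ℕ} (hc : c ≠ 0)
    (h𝒯σ : ∀ (v w : HeightOneSpectrum (𝓞 K)) (h : τ • v = w), v ∈ placesDividing K c →
      ∀ x : galoisCohomology (((W.baseChange K).torsionGaloisModule ((p ^ k : ℕ) : ℤ)).toLocal
        (Sum.inr v : Place K)) 1,
      x ∈ 𝒯 (Sum.inr v) → conjActPlace W τ ((p ^ k : ℕ) : ℤ) h x ∈ 𝒯 (Sum.inr w))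
    (h𝒯sd : ∀ v ∈ placesDividing K c,
      inv.dualTransported 𝒯 (weilDualIntertwining (W.baseChange K) (p ^ k) e hμ hadd₁ hadd₂ hgal)
        (Sum.inr v) = 𝒯 (Sum.inr v))
    {s : ℤ} (hs : s = 1 ∨ s = -1) {q : ℕ} (hq : q.Prime)
    (hloc : ∀ ℓ : ℕ, Zhang2014.IsKolyvaginPrime (W.conductorNorm ℤ) W K p ℓ →
      k ≤ Zhang2014.kolyvaginIndex W p ℓ → ℓ ∉ c.primeFactors →
      ∀ (v : HeightOneSpectrum (𝓞 K)), (ℓ : 𝓞 K) ∈ v.asIdeal → ∀ (hfix : τ • v = v),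
      ((W.baseChange K).kummerSelmerStructure ((p ^ k : ℕ) : ℤ) (Sum.inr v)).relIndex
        ((conjActPlace W τ ((p ^ k : ℕ) : ℤ) hfix - s • AddMonoidHom.id _).ker) = q)
    {v₀ : HeightOneSpectrum (𝓞 K)} (hv₀ : τ • v₀ = v₀) (hv₀c : v₀ ∉ placesDividing K c)
    {ℓ : ℕ} (hKol : Zhang2014.IsKolyvaginPrime (W.conductorNorm ℤ) W K p ℓ)
    (hkℓ : k ≤ Zhang2014.kolyvaginIndex W p ℓ) (hℓc : ℓ ∉ c.primeFactors)
    {v : HeightOneSpectrum (𝓞 K)} (hv : (ℓ : 𝓞 K) ∈ v.asIdeal) (hvv₀ : v ≠ v₀)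
    (y : galoisCohomology ((W.baseChange K).torsionGaloisModule ((p ^ k : ℕ) : ℤ)) 1)
    (hys : conjAct W τ ((p ^ k : ℕ) : ℤ) y = s • y)
    (hyF : ∀ w : HeightOneSpectrum (𝓞 K), w ≠ v₀ → w ≠ v →
      galoisCohomology.localization ((W.baseChange K).torsionGaloisModule ((p ^ k : ℕ) : ℤ))
        (Sum.inr w : Place K) 1 y ∈ selmerF W ((p ^ k : ℕ) : ℤ) 𝒯 (placesDividing K c) (Sum.inr w))
    (hy0 : galoisCohomology.localization ((W.baseChange K).torsionGaloisModule ((p ^ k : ℕ) : ℤ))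
        (Sum.inr v₀ : Place K) 1 y = 0)
    (hyv : galoisCohomology.localization ((W.baseChange K).torsionGaloisModule ((p ^ k : ℕ) : ℤ))
        (Sum.inr v : Place K) 1 y ∉
      (W.baseChange K).kummerSelmerStructure ((p ^ k : ℕ) : ℤ) (Sum.inr v))
    (t : galoisCohomology ((W.baseChange K).torsionGaloisModule ((p ^ k : ℕ) : ℤ)) 1)
    (hts : conjAct W τ ((p ^ k : ℕ) : ℤ) t = s • t)
    (htF : t ∈ ((selmerF W ((p ^ k : ℕ) : ℤ) 𝒯 (placesDividing K c)).relaxedAt {v₀}).selmerGroup) :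
    galoisCohomology.localization ((W.baseChange K).torsionGaloisModule ((p ^ k : ℕ) : ℤ))
      (Sum.inr v : Place K) 1 t = 0 := by
  -- basic facts
  have hpr : p.Prime := Fact.out
  have hodd : Odd (p ^ k) := (hpr.odd_of_ne_two hp2).pow
  have hk0 : k ≠ 0 := by omega
  have hppow : IsPrimePow (p ^ k) := ⟨p, k, hpr.prime, Nat.pos_of_ne_zero hk0, rfl⟩
  have hM : ∀ P : geomTorsion (W.baseChange K) ((p ^ k : ℕ) : ℤ), (p ^ k) • P = 0 := fun P => by
    simpa using (W.baseChange K).natAbs_nsmul_geomTorsion P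
  have hinj : ∀ v : HeightOneSpectrum (𝓞 K), Injective (inv (Sum.inr v)) := fun v => (hperf v).1.injective
  -- the prime `λ = v`: fixed, prime to `c`
  have hℓ : ℓ.Prime := hKol.1
  have hfix : τ • v = v := smul_place_eq_self_of_natCast_mem τ hℓ.ne_zero hKol.2.2.2.2.1 v hv
  have hvc : v ∉ placesDividing K c := by
    rw [mem_placesDividing_iff_natCast_mem hc]
    refine natCast_notMem_of_coprime ((Nat.Prime.coprime_iff_not_dvd hℓ).mpr fun h => ?_) _ hv
    exact hℓc (Nat.mem_primeFactors.mpr ⟨hℓ, h, hc⟩)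
  -- the structures `𝓕(c)`, `F := 𝓕(c)[v₀ ↦ 0]`, and their properties
  set Fc := selmerF W ((p ^ k : ℕ) : ℤ) 𝒯 (placesDividing K c) with hFc
  set F : SelmerStructure ((W.baseChange K).torsionGaloisModule ((p ^ k : ℕ) : ℤ)) :=
    Function.update Fc (Sum.inr v₀) ⊥ with hFdef
  set Kum := (W.baseChange K).kummerSelmerStructure ((p ^ k : ℕ) : ℤ) with hKum
  set loc := galoisCohomology.localization ((W.baseChange K).torsionGaloisModule ((p ^ k : ℕ) : ℤ))
    (Sum.inr v : Place K) 1 with hlocdef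
  have hFv₀ : F (Sum.inr v₀) = ⊥ := by rw [hFdef, Function.update_self]
  have hFne : ∀ w : Place K, w ≠ Sum.inr v₀ → F w = Fc w := fun w hw => by
    rw [hFdef, Function.update_of_ne hw]
  have hFcσ := conjActPlace_mem_selmerF W τ ((p ^ k : ℕ) : ℤ) 𝒯 hc h𝒯σ
  have hFσ : ∀ (v w : HeightOneSpectrum (𝓞 K)) (h : τ • v = w)
      (x : galoisCohomology (((W.baseChange K).torsionGaloisModule ((p ^ k : ℕ) : ℤ)).toLocal
        (Sum.inr v : Place K)) 1), x ∈ F (Sum.inr v) → conjActPlace W τ ((p ^ k : ℕ) : ℤ) h x ∈ F (Sum.inr w) := by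
    intro v' w h x hx
    by_cases hv' : v' = v₀
    · subst hv'
      have hw : w = v' := h ▸ hv₀.symm ▸ rfl
      subst hw
      rw [hFv₀] at hx ⊢
      rw [AddSubgroup.mem_bot] at hx
      rw [hx, map_zero]
      exact zero_mem _
    · have hw : w ≠ v₀ := by
        rintro rfl
        apply hv'
        have : τ • (τ • v') = τ • w := by rw [h]
        rw [← mul_smul, hτ, one_smul, hv₀] at this
        exact this
      rw [hFne _ (fun h' => hv' (Sum.inr_injective h'))] at hx
      rw [hFne _ (fun h' => hw (Sum.inr_injective h'))]
      exact hFcσ v' w h x hx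
  have hFinf : ∀ w : InfinitePlace K, F (Sum.inl w) = ⊤ := fun w =>
    addSubgroup_inl_eq_top_of_odd W (p ^ k) hodd w _
  have hFdinf : ∀ w : InfinitePlace K,
      inv.dualSelmerStructure ((W.baseChange K).torsionGaloisModule ((p ^ k : ℕ) : ℤ)) F (Sum.inl w) = ⊤ :=
    fun w => addSubgroup_tateDual_inl_eq_top_of_odd W (p ^ k) hodd w _
  have hFv : F (Sum.inr v) = Kum (Sum.inr v) := by
    rw [hFne _ (fun h' => hvv₀ (Sum.inr_injective h')), hFc, selmerF_inr, if_neg hvc]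
  -- an exceptional set containing `λ` and `λ₀`
  obtain ⟨S, T, hPT, hST, hTσ, -, hSram, h𝓚⟩ :=
    exists_symmetric_exceptional W τ p k hτ (placesDividing K c ∪ {v, v₀})
  have hcS : ∀ v ∈ placesDividing K c, (Sum.inr v : Place K) ∈ S := fun v hv =>
    (hST v).mpr (hPT (Finset.mem_union_left _ hv))
  have hvT : v ∈ T := hPT (Finset.mem_union_right _ (Finset.mem_insert_self v _))
  have hv₀T : v₀ ∈ T :=
    hPT (Finset.mem_union_right _ (Finset.mem_insert_of_mem (Finset.mem_singleton_self v₀)))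
  have hFcunr := selmerF_isUnramifiedOutside W ((p ^ k : ℕ) : ℤ) 𝒯 (c := c) h𝓚 hcS
  have hFunr : F.IsUnramifiedOutside S := by
    refine ⟨hFcunr.1, fun w hw => ?_⟩
    rw [hFne _ (fun h' => hw (by rw [h']; exact (hST v₀).mpr hv₀T))]
    exact hFcunr.2 w hw
  -- the signed counting for `F ≤ F^λ`
  have key := relIndex_mul_natCard_map_eq_of_relaxedAt W τ ((p ^ k : ℕ) : ℤ) hτ hodd hM inv hperf hvan
    hSC hinv S T hST hTσ hSram hFunr hFσ hFinf hFdinf hvT hfix hs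
  rw [hFv, hloc ℓ hKol hkℓ hℓc v hv hfix] at key
  -- `y` lies in the relaxed group and not in the strict one: the first factor is `≠ 1`
  have hyrel : y ∈ signPart W K τ ((p ^ k : ℕ) : ℤ) s (F.relaxedAt {v}).selmerGroup := by
    refine (mem_signPart_iff W K τ _ s _ y).mpr ⟨?_, hys⟩
    rw [SelmerStructure.mem_selmerGroup_iff]
    intro w
    rcases w with w | w
    · rw [relaxedAt_inl, hFinf]
      trivial
    · by_cases hwv : w = v
      · subst hwv
        rw [relaxedAt_inr_self]
        trivial
      · rw [relaxedAt_inr_of_ne W _ F hwv]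
        by_cases hwv₀ : w = v₀
        · subst hwv₀
          rw [hFv₀, hy0]
          exact zero_mem _
        · rw [hFne _ (fun h' => hwv₀ (Sum.inr_injective h'))]
          exact hyF w hwv₀ hwv
  have hynot : y ∉ signPart W K τ ((p ^ k : ℕ) : ℤ) s F.selmerGroup := by
    intro hy
    have hyFm := ((mem_signPart_iff W K τ _ s _ y).mp hy).1
    rw [SelmerStructure.mem_selmerGroup_iff] at hyFm
    have := hyFm (Sum.inr v)
    rw [hFv] at this
    exact hyv this
  have hne : (F.selmerGroup ⊓ (conjAct W τ ((p ^ k : ℕ) : ℤ) - s • AddMonoidHom.id _).ker).relIndex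
      ((F.relaxedAt {v}).selmerGroup ⊓ (conjAct W τ ((p ^ k : ℕ) : ℤ) - s • AddMonoidHom.id _).ker) ≠ 1 := by
    rw [Ne, AddSubgroup.relIndex_eq_one]
    intro hle
    exact hynot (show y ∈ signPart W K τ ((p ^ k : ℕ) : ℤ) s F.selmerGroup from hle hyrel)
  have hcard := eq_one_of_mul_eq_prime hq key hne
  -- `t` lies in the transported dual of `F`: `F^∨ = 𝓕(c)^{v₀}`
  have hsd : ∀ w, inv.dualTransported Fc
      (weilDualIntertwining (W.baseChange K) (p ^ k) e hμ hadd₁ hadd₂ hgal) w = Fc w :=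
    dualTransported_selmerF_eq W (p ^ k) e hμ hadd₁ hadd₂ hgal halt hnondeg hppow hodd inv hinj 𝒯 c h𝒯sd
  have htF' : t ∈ (inv.dualTransported F
      (weilDualIntertwining (W.baseChange K) (p ^ k) e hμ hadd₁ hadd₂ hgal)).selmerGroup := by
    rw [SelmerStructure.mem_selmerGroup_iff] at htF ⊢
    intro w
    rw [hFdef, dualTransported_update_bot W (p ^ k) e hμ hadd₁ hadd₂ hgal inv Fc (Sum.inr v₀) w]
    by_cases hw : w = Sum.inr v₀
    · rw [if_pos hw]
      trivial
    · rw [if_neg hw, hsd w]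
      have := htF w
      rcases w with w | w
      · rwa [relaxedAt_inl] at this
      · rwa [relaxedAt_inr_of_ne W _ Fc (fun h' => hw (by rw [h']))] at this
  exact localization_eq_zero_of_natCard_dualImage_eq_one W τ (p ^ k) e hμ hadd₁ hadd₂ hgal hnondeg hτe
    inv F (Sum.inr v) s hcard t htF' hts

end Exclusion

end Summit.BirchSwinnertonDyer.Rank1Residual.JET.Swap

end
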